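import Literature.Probability.Percolation.ArmSeparationThinRing
import HarnessLib

/-!
# Level connectors of the staircase corridors: tubes joining two chunked rings

Topic: Probability / Percolation; family `crit-perc`. A brick of the GENERIC landing layer of
Nolin's arm-separation theorem (Nolin 2008, Thm. 11, §4.3 Prop. 12 and §4.4 [arXiv 0711.4948:
Prop. 11, Thm. 10, p. 12, Fig. 6: "RSW in corridors"]), towards
`Literature.Probability.Percolation.Nolin2008_prop17_quasiMult` (`FiveArmExponentFacts.lean`).

A staircase corridor climbs from the thin ring of radius `r` to the thin ring of radius `r'`
(`r < r'`, both multiples of the chunk `s`, so that the pieces of the two rings are aligned: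
`thinRing r e s`, `ArmSeparationThinRing.lean`) through a LEVEL CONNECTOR, a tube crossing — in
the plus configuration `Tube.Crosses` of the chain lemmas — one piece of each ring at the same
lateral position: on the vertical side `x₀ = r` a horizontal tube through the vertical pieces
`vPiece`, on the horizontal side `x₁ = r` and on the diagonal side `x₀ + x₁ = r` a vertical tube
through the horizontal pieces `hPiece` / steps `stairH`; the three other sides by central
reflection (`Tube.neg`, `crosses_neg`). With these, the tube chain of a corridor
(`rot_exit_landing_move_chain'`, `TrapExitChainMove.lean`) is a `List.IsChain Crosses` chain:
arc at level `r` (ending at the crossed piece), connector, arc at level `r'` (starting at the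
crossed piece), …

## Main definitions

* `Staircase.connV r r' e' y` — the horizontal connector of the vertical side at row `y`;
* `Staircase.connH x r r' e' ` — the vertical connector of the horizontal side at column `x`;
* `Staircase.connD r r' e' s j` — the vertical connector of the diagonal side through the
  `j`-th step of the inner staircase.

## Main results

* `crosses_vPiece_connV`, `crosses_connV_vPiece` — the connector of the vertical side crosses the
  aligned vertical pieces of both rings;
* `crosses_hPiece_connH`, `crosses_connH_hPiece` — the same on the horizontal side;
* `crosses_stairH_connD`, `crosses_connD_stairH` — the same on the diagonal side;
* `connV_box`, `connH_box`, `connD_box` — the connector boxes lie between the two rings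
  (coordinates), for the disjointness of the regions.

## References

* P. Nolin, *Near-critical percolation in two dimensions*, Electron. J. Probab. 13 (2008), §4.3
  Prop. 12 (proof), §4.4 (arXiv 0711.4948: Prop. 11; proof of Thm. 10, p. 12, Fig. 6). [Nolin2008]
* H. Kesten, *Scaling relations for 2D-percolation*, Comm. Math. Phys. 109 (1987), Lemma 4.
  [Kesten1987]
-/

namespace Literature.Probability.Percolation

open LatticeModels Tube

namespace Staircase

/-- **The level connector of the vertical side** `x₀ = r → x₀ = r'`: the horizontal tube
`[r - e', r' + e'] × [y - e', y + e']`. [cite: Nolin2008, §4.4 (arXiv 0711.4948: proof of Thm. 10, p. 12, Fig. 6)] -/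
def connV (r r' e' : ℕ) (y : ℤ) : Tube := ⟨(r : ℤ) - e', y - e', (r' - r) + 2 * e', 2 * e', true⟩

/-- **The level connector of the horizontal side** `x₁ = r → x₁ = r'` at the column `x`: the
vertical tube `[x - e', x + e'] × [r - e', r' + e']`. [cite: Nolin2008, §4.4 (arXiv 0711.4948: proof of Thm. 10, p. 12, Fig. 6)] -/
def connH (x : ℤ) (r r' e' : ℕ) : Tube := ⟨x - e', (r : ℤ) - e', 2 * e', (r' - r) + 2 * e', false⟩

/-- **The level connector of the diagonal side** `x₀ + x₁ = r → x₀ + x₁ = r'` through the `j`-th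
horizontal step of the inner staircase (row `js`, columns `[r - (j+1)s, r - js]`) and the aligned
step of the outer one (row `js + (r' - r)`): the vertical tube of half-width `e'` about the
middle column `r - js - s/2`, rows `[js - e', js + (r' - r) + e']`. [cite: Nolin2008, §4.4 (arXiv 0711.4948: proof of Thm. 10, p. 12, Fig. 6)] -/
def connD (r r' e' s j : ℕ) : Tube :=
  ⟨(r : ℤ) - j * s - (s / 2 : ℕ) - e', (j : ℤ) * s - e', 2 * e', (r' - r) + 2 * e', false⟩

variable {r r' e e' s : ℕ}

/-! ### The vertical side -/

/-- **The inner vertical piece crosses the connector** (piece `j` of the side `x₀ = r` from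
`(r, -r)`: its rows `[-r + js, -r + (j+1)s]` contain the rows `[y - e', y + e']` of the connector,
and the connector, at least `e`-wide beyond `x₀ = r` on both sides (`e ≤ e'`, `r ≤ r'`), contains
its columns). [folklore] -/
theorem crosses_vPiece_connV (hrr' : r ≤ r') (hee' : e ≤ e') {y : ℤ} {j : ℕ}
    (hy : -(r : ℤ) + j * s ≤ y - e' ∧ y + e' ≤ -(r : ℤ) + (j + 1) * s) :
    Crosses (vPiece r (-(r : ℤ)) e s j) (connV r r' e' y) := by
  have hrr : (r : ℤ) ≤ r' := by exact_mod_cast hrr'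
  have hee : (e : ℤ) ≤ e' := by exact_mod_cast hee'
  refine Or.inr ⟨rfl, rfl, ?_, ?_, ?_, ?_⟩ <;> simp only [vPiece, connV] <;> push_cast <;> nlinarith [hy.1, hy.2]

/-- **The connector crosses the outer vertical piece** (piece `j'` of the side `x₀ = r'`). [folklore] -/
theorem crosses_connV_vPiece (hrr' : r ≤ r') (hee' : e ≤ e') {y : ℤ} {j' : ℕ}
    (hy : -(r' : ℤ) + j' * s ≤ y - e' ∧ y + e' ≤ -(r' : ℤ) + (j' + 1) * s) :
    Crosses (connV r r' e' y) (vPiece r' (-(r' : ℤ)) e s j') := by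
  have hrr : (r : ℤ) ≤ r' := by exact_mod_cast hrr'
  have hee : (e : ℤ) ≤ e' := by exact_mod_cast hee'
  have hsub : ((r' - r : ℕ) : ℤ) = r' - r := by push_cast [Nat.cast_sub hrr']; ring
  refine Or.inl ⟨rfl, rfl, ?_, ?_, ?_, ?_⟩ <;> simp only [vPiece, connV] <;> push_cast [Nat.cast_sub hrr'] <;>
    nlinarith [hy.1, hy.2]

/-! ### The horizontal side -/

/-- **The inner horizontal piece crosses the connector** (piece `j` of the side `x₁ = r` from
`(0, r)` leftwards: columns `[-(j+1)s, -js]` contain the columns of the connector). [folklore] -/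
theorem crosses_hPiece_connH (hrr' : r ≤ r') (hee' : e ≤ e') {x : ℤ} {j : ℕ}
    (hx : -(((j : ℤ) + 1) * s) ≤ x - e' ∧ x + e' ≤ -((j : ℤ) * s)) :
    Crosses (hPiece 0 r e s j) (connH x r r' e') := by
  have hrr : (r : ℤ) ≤ r' := by exact_mod_cast hrr'
  have hee : (e : ℤ) ≤ e' := by exact_mod_cast hee'
  refine Or.inl ⟨rfl, rfl, ?_, ?_, ?_, ?_⟩ <;> simp only [hPiece, connH] <;> push_cast [Nat.cast_sub hrr'] <;>
    nlinarith [hx.1, hx.2]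

/-- **The connector crosses the outer horizontal piece** (piece `j` of the side `x₁ = r'`: same
columns). [folklore] -/
theorem crosses_connH_hPiece (hrr' : r ≤ r') (hee' : e ≤ e') {x : ℤ} {j : ℕ}
    (hx : -(((j : ℤ) + 1) * s) ≤ x - e' ∧ x + e' ≤ -((j : ℤ) * s)) :
    Crosses (connH x r r' e') (hPiece 0 r' e s j) := by
  have hrr : (r : ℤ) ≤ r' := by exact_mod_cast hrr'
  have hee : (e : ℤ) ≤ e' := by exact_mod_cast hee'
  refine Or.inr ⟨rfl, rfl, ?_, ?_, ?_, ?_⟩ <;> simp only [hPiece, connH] <;> push_cast [Nat.cast_sub hrr'] <;>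
    nlinarith [hx.1, hx.2]

/-! ### The diagonal side -/

/-- **The inner horizontal step crosses the diagonal connector** (the connector columns, within
`e' ≤ s/2` of the middle column of the step, lie inside the step; its rows start `e' ≥ e` below
the step row). [folklore] -/
theorem crosses_stairH_connD (hrr' : r ≤ r') (hee' : e ≤ e') (hes : 2 * e' ≤ s) (j : ℕ) :
    Crosses (stairH r e s j) (connD r r' e' s j) := by
  have hrr : (r : ℤ) ≤ r' := by exact_mod_cast hrr'
  have hee : (e : ℤ) ≤ e' := by exact_mod_cast hee'
  have hes' : 2 * (e' : ℤ) ≤ s := by exact_mod_cast hes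
  have h5 : (e' : ℤ) ≤ (s : ℤ) / 2 := by omega
  have h6 : 2 * ((s : ℤ) / 2) ≤ s := by omega
  have hj : ((j : ℤ) + 1) * s = j * s + s := by ring
  refine Or.inl ⟨rfl, rfl, ?_, ?_, ?_, ?_⟩ <;> simp only [stairH, connD] <;> push_cast [Nat.cast_sub hrr'] <;>
    nlinarith [h5, h6, hj]

/-- **The diagonal connector crosses the aligned outer step** (`(r' - r) = q s`: the step
`j + q` of the outer staircase has the same columns, row `js + (r' - r)`). [folklore] -/
theorem crosses_connD_stairH (hrr' : r ≤ r') (hee' : e ≤ e') (hes : 2 * e' ≤ s) (j : ℕ) {q : ℕ} (hq : r' - r = q * s) :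
    Crosses (connD r r' e' s j) (stairH r' e s (j + q)) := by
  have hrr : (r : ℤ) ≤ r' := by exact_mod_cast hrr'
  have hee : (e : ℤ) ≤ e' := by exact_mod_cast hee'
  have hes' : 2 * (e' : ℤ) ≤ s := by exact_mod_cast hes
  have h5 : (e' : ℤ) ≤ (s : ℤ) / 2 := by omega
  have h6 : 2 * ((s : ℤ) / 2) ≤ s := by omega
  have hq' : ((r' : ℤ) - r) = q * s := by
    have : ((r' - r : ℕ) : ℤ) = (q * s : ℕ) := by exact_mod_cast hq
    push_cast [Nat.cast_sub hrr'] at this; exact this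
  have hj : ((j : ℤ) + q + 1) * s = j * s + q * s + s := by ring
  refine Or.inr ⟨rfl, rfl, ?_, ?_, ?_, ?_⟩ <;> simp only [stairH, connD] <;> push_cast [Nat.cast_sub hrr'] <;>
    nlinarith [hq', h5, h6, hj]

/-! ### Where the connectors are -/

/-- The box of the connector of the vertical side: columns `[r - e', r' + e']`, rows `[y - e', y + e']`. [folklore] -/
theorem connV_box (hrr' : r ≤ r') {y : ℤ} {v : Site 2} (hv : v ∈ (connV r r' e' y).box) :
    (r : ℤ) - e' ≤ v 0 ∧ v 0 ≤ r' + e' ∧ y - e' ≤ v 1 ∧ v 1 ≤ y + e' := by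
  rw [Tube.box, mem_triStrip] at hv
  simp only [connV] at hv
  push_cast [Nat.cast_sub hrr'] at hv
  omega

/-- The box of the connector of the horizontal side: columns `[x - e', x + e']`, rows `[r - e', r' + e']`. [folklore] -/
theorem connH_box (hrr' : r ≤ r') {x : ℤ} {v : Site 2} (hv : v ∈ (connH x r r' e').box) :
    x - e' ≤ v 0 ∧ v 0 ≤ x + e' ∧ (r : ℤ) - e' ≤ v 1 ∧ v 1 ≤ r' + e' := by
  rw [Tube.box, mem_triStrip] at hv
  simp only [connH] at hv
  push_cast [Nat.cast_sub hrr'] at hv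
  omega

/-- The box of the diagonal connector: columns within `e'` of the middle column of the step,
rows `[js - e', js + (r' - r) + e']`. [folklore] -/
theorem connD_box (hrr' : r ≤ r') {j : ℕ} {v : Site 2} (hv : v ∈ (connD r r' e' s j).box) :
    (r : ℤ) - j * s - (s / 2 : ℕ) - e' ≤ v 0 ∧ v 0 ≤ (r : ℤ) - j * s - (s / 2 : ℕ) + e' ∧
      (j : ℤ) * s - e' ≤ v 1 ∧ v 1 ≤ (j : ℤ) * s + (r' - r) + e' := by
  rw [Tube.box, mem_triStrip] at hv
  simp only [connD] at hv
  push_cast [Nat.cast_sub hrr'] at hv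
  omega

end Staircase

end Literature.Probability.Percolation
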